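import Summits.BirchSwinnertonDyer.Rank1Residual.ManinAdditive.ShimuraIndexFrickeLaw
import HarnessLib

/-!
# THE ATKIN–LEHNER SIGN LAWS FOR THE SHIMURA INDEX and the `9 ∥ N` SIGN LAW — E-es-71 / E-es-71♮ / E-es-72 / E-es-72♮ /
# E-es-67♯₂₇ and the PROVED chain to E-es-67♯ (cell `bsd-f2-manin`; part 2/2 of the conjecture leaf typed by the typer g13
# from planner es g20's Sketch-es-g20 845cdde0b49804cc, §3–§5 VERBATIM, T-es-25; part 1/2 = `ShimuraIndexFrickeLaw.lean`)

TYPER FRAMING.  See part 1 for the objects (`ShimuraIndexPrimeTo`, THEOREM F).  Laws here are `@[conjecture] def … : Prop`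
obligations: E-es-71 `AtkinLehnerShimuraSignLaw`, E-es-71♮ `ShimuraCharacterSupportLaw` (THEOREM AL on paper, MEMO-es §33.4),
E-es-72 `MuThreeOptimalSignAtNine`, E-es-72♮ `ThreeTorsionOptimalSignAtNine` (the SIGN LAW, empirical, E44b/c), E-es-67♯₂₇
`PlusIndexPrimeToThreeOfMuThreeAt27` (the honest residual law at `27 ∣ N`, E44a); every `theorem` is kernel-checked.
TURNKEY-es-11 (for the C3 LEAD): on the μ₃-residue cut use `plusIndexPrimeToThreeOfMuThreeNoRationalThreeTorsion_of_laws hCH hS h27`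
(binders: 71♮, 72, 67♯₂₇); on root number `−1` use `threeAdicPolarWitness_of_rootNumber_eq_neg_one h66` (no residue).
REF1 R-es-39 / REF2 P-es-13 pending at typing time (verdicts folded at the next substantive touch, repairs under NEW names).
bears_on: stmt-BirchSwinnertonDyer-22968.  PARTITION 0.  BSD is not proved by this; Manin's conjecture is not proved by this.
-/

noncomputable section

open scoped Classical MatrixGroups ModularForm ComplexConjugate

open CongruenceSubgroup Complex WeierstrassCurve UpperHalfPlane Literature.NumberTheory.EllipticCurves
  Literature.NumberTheory.EllipticCurves.ModularForms

namespace Summit.BirchSwinnertonDyer.Rank1Residual.ManinAdditive.KatoCurve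

open Summit.BirchSwinnertonDyer.Rank1Residual.ManinAdditive.CuspidalKummer
  Summit.BirchSwinnertonDyer.Rank1Residual.ManinAdditive.CuspidalKummerThree

/-! ### §3. THEOREM AL — the Atkin–Lehner sign law for the Shimura index (E-es-71, E-es-71♮) -/

/-- **E-es-71** (THEOREM AL, es g20; paper proof MEMO-es §33.4, typed as a law): for a newform `f` on
`Γ₀(N)` and an odd prime `p` with `p ∣ [Λ₀(f) : Λ₁(f)]`, EXACTLY ONE prime `q ∣ N` has Atkin–Lehner sign
`ε_{q^{v_q N}}(f) = −1`.  Mechanism: a surjection `Λ₀ ↠ ℤ/p` killing `Λ₁` is a character `ε∘d` of `(ℤ/N)ˣ`;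
`w_Q` acts on `(ℤ/N)ˣ` by inversion on the `Q`-component (Atkin–Li) and on the `f`-line by `ε_Q(f)`, whence
`ε_Q(f) = +1 ⟹ ε` trivial on the `Q`-component and `ε_Q(f) = −1 ⟹ ε` supported on the `Q`-component (`p` odd).
Subsumes THEOREM F (`0` primes with sign `−1` is `ε_N = +1`). -/
@[conjecture]
def AtkinLehnerShimuraSignLaw : Prop :=
  ∀ (N : ℕ) [NeZero N] (f : CuspForm (Gamma0 N) 2), IsNewform0 f → ∀ p : ℕ, p.Prime → p ≠ 2 →
    ¬ ShimuraIndexPrimeTo p f → ∃! q : ℕ, q.Prime ∧ q ∣ N ∧ atkinLehnerEigenvalueAt f q = -1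

/-- **E-es-71♮** (THEOREM AL, support half): under the same hypotheses the Shimura character lives on the
unique `Q₀ = q^{v_q N}` with sign `−1`, so the image of `(ℤ/Q₀)ˣ` in Ling–Oesterlé's `Q_N` has `p`-torsion:
`q ≠ p` and `p ∣ q − 1`, or `q = p` and `p³ ∣ N` (the cusp of denominator `p` kills `1 + N/p`). -/
@[conjecture]
def ShimuraCharacterSupportLaw : Prop :=
  ∀ (N : ℕ) [NeZero N] (f : CuspForm (Gamma0 N) 2), IsNewform0 f → ∀ p : ℕ, p.Prime → p ≠ 2 →
    ¬ ShimuraIndexPrimeTo p f → ∀ q : ℕ, q.Prime → q ∣ N → atkinLehnerEigenvalueAt f q = -1 →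
      (q ≠ p ∧ p ∣ q - 1) ∨ (q = p ∧ p ^ 3 ∣ N)

/-- COROLLARY (PROVED from E-es-71♮): Atkin–Lehner sign `−1` at `p` itself with `p³ ∤ N` forces
`p ∤ [Λ₀ : Λ₁]`. -/
theorem shimuraIndexPrimeTo_of_signAtP (hCH : ShimuraCharacterSupportLaw)
    {N : ℕ} [NeZero N] (f : CuspForm (Gamma0 N) 2) (hf : IsNewform0 f) {p : ℕ} (hp : p.Prime)
    (hp2 : p ≠ 2) (hpN : p ∣ N) (hp3 : ¬ p ^ 3 ∣ N) (hε : atkinLehnerEigenvalueAt f p = -1) :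
    ShimuraIndexPrimeTo p f := by
  by_contra h
  rcases hCH N f hf p hp hp2 h p hp hpN hε with ⟨hne, _⟩ | ⟨_, h3⟩
  · exact hne rfl
  · exact hp3 h3

/-- COROLLARY (PROVED from E-es-71): two distinct primes with sign `−1` force `p ∤ [Λ₀ : Λ₁]` for every odd
`p` (e.g. two split-multiplicative primes `q ∥ N`, `a_q = +1`). -/
theorem shimuraIndexPrimeTo_of_two_signs (hAL : AtkinLehnerShimuraSignLaw) {N : ℕ} [NeZero N]
    (f : CuspForm (Gamma0 N) 2) (hf : IsNewform0 f) {p : ℕ} (hp : p.Prime) (hp2 : p ≠ 2) {q₁ q₂ : ℕ}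
    (hq : q₁ ≠ q₂) (hq₁ : q₁.Prime) (hq₂ : q₂.Prime) (h₁N : q₁ ∣ N) (h₂N : q₂ ∣ N)
    (hε₁ : atkinLehnerEigenvalueAt f q₁ = -1) (hε₂ : atkinLehnerEigenvalueAt f q₂ = -1) :
    ShimuraIndexPrimeTo p f := by
  by_contra h
  obtain ⟨q, _, huniq⟩ := hAL N f hf p hp hp2 h
  exact hq ((huniq q₁ ⟨hq₁, h₁N, hε₁⟩).trans (huniq q₂ ⟨hq₂, h₂N, hε₂⟩).symm)

/-- Hence (PROVED from E-es-71): two distinct primes with sign `−1` ⟹ plus index prime to every odd `p`. -/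
theorem plusIndexPrimeTo_of_two_signs (hAL : AtkinLehnerShimuraSignLaw) {N : ℕ} [NeZero N]
    (f : CuspForm (Gamma0 N) 2) (hf : IsNewform0 f) {p : ℕ} (hp : p.Prime) (hp2 : p ≠ 2) {q₁ q₂ : ℕ}
    (hq : q₁ ≠ q₂) (hq₁ : q₁.Prime) (hq₂ : q₂.Prime) (h₁N : q₁ ∣ N) (h₂N : q₂ ∣ N)
    (hε₁ : atkinLehnerEigenvalueAt f q₁ = -1) (hε₂ : atkinLehnerEigenvalueAt f q₂ = -1) :
    PlusIndexPrimeTo p f :=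
  plusIndexPrimeTo_of_shimuraIndexPrimeTo hp f
    (shimuraIndexPrimeTo_of_two_signs hAL f hf hp hp2 hq hq₁ hq₂ h₁N h₂N hε₁ hε₂)

/-! ### §4. THE SIGN LAW at `9 ∥ N` (E-es-72 / E-es-72♮; NEW, empirical) -/

/-- **E-es-72** `MuThreeOptimalSignAtNine` (es g20 SIGN LAW, empirical): an `X₀(N)`-optimal `W` with `9 ∥ N`,
`μ₃ ⊂ W` and no rational `3`-torsion has Atkin–Lehner sign `ε₉(f) = w₃(W) = −1` (equivalently: Kodaira type
`I₀*` or `Iₙ*` at `3`, never `III`/`III*`).  BC5: E44b 1 788 / 1 788 optimal classes `N = 9M < 10⁵`, `M`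
squarefree (HOME/es/e44-src/g20_eps3.py); E44c: the same classes have `v₃(c₄, c₆, Δ) = (2, 3, 6)` (607) or
potentially multiplicative `v₃(Δ) ∈ 9 + 3ℕ` (1 181), none of type `III`.  Cheapest falsifier: one optimal
`μ₃`-curve with `9 ∥ N` and `w₃ = +1`. -/
@[conjecture]
def MuThreeOptimalSignAtNine : Prop :=
  ∀ (W : WeierstrassCurve ℚ) [W.IsElliptic] [W.IsGloballyMinimal] {N : ℕ} [NeZero N]
    (D : ModularParametrizationData W N),
    (∀ z ∈ D.L.lattice, ∃ w ∈ periodLattice D.f, z = D.c * w) → 3 ^ 2 ∣ N → ¬ 3 ^ 3 ∣ N →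
    HasShortMuThree W D.c → (∀ X₀ Y₀ : ℚ, ¬ IsShortThreeTorsion W D.c X₀ Y₀) →
    atkinLehnerEigenvalueAt D.f 3 = -1

/-- **E-es-72♮** `ThreeTorsionOptimalSignAtNine` (twin, empirical): an optimal `W` with `9 ∥ N` and a rational
point of order `3` has `ε₉(f) = w₃(W) = +1` (Kodaira type `III` at `3`, `v₃(Δ) = 3`).  BC5: E44b 662 / 662;
E44c: `v₃(c₆, Δ) = (3, 3)` in all 662. -/
@[conjecture]
def ThreeTorsionOptimalSignAtNine : Prop :=
  ∀ (W : WeierstrassCurve ℚ) [W.IsElliptic] [W.IsGloballyMinimal] {N : ℕ} [NeZero N]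
    (D : ModularParametrizationData W N),
    (∀ z ∈ D.L.lattice, ∃ w ∈ periodLattice D.f, z = D.c * w) → 3 ^ 2 ∣ N → ¬ 3 ^ 3 ∣ N →
    (∃ X₀ Y₀ : ℚ, IsShortThreeTorsion W D.c X₀ Y₀) → atkinLehnerEigenvalueAt D.f 3 = 1

/-! ### §5. THE CHAIN to E-es-67♯ (PROVED edges) -/

/-- E-es-67♯ restricted to `27 ∣ N` — the honest residual LAW.  E44a: of the 3 381 `μ₃`-classes `N < 10⁵`
exactly 58 survive the Hecke / traceless / Atkin–Lehner / support sieves, all with `27 ∣ N`, all of type R1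
(one prime `q ∥ N`, `q ≡ 1 (3)`, `a_q = +1`; `ε_{3^k} = +1`; rank 0 (52) or 2 (6); `3 ∣ m_f` in all 58). -/
@[conjecture]
def PlusIndexPrimeToThreeOfMuThreeAt27 : Prop :=
  ∀ (W : WeierstrassCurve ℚ) [W.IsElliptic] [W.IsGloballyMinimal] {N : ℕ} [NeZero N]
    (D : ModularParametrizationData W N),
    (∀ z ∈ D.L.lattice, ∃ w ∈ periodLattice D.f, z = D.c * w) → 3 ^ 3 ∣ N →
    HasShortMuThree W D.c → (∀ X₀ Y₀ : ℚ, ¬ IsShortThreeTorsion W D.c X₀ Y₀) → PlusIndexPrimeTo 3 D.f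

/-- **E-es-67♯ on `9 ∥ N` from the laws** (PROVED): AL-support law E-es-71♮ ∧ SIGN LAW E-es-72 ⟹ plus index prime to `3`
for every optimal `μ₃`-curve with `9 ∥ N` and no rational `3`-torsion. -/
theorem plusIndexPrimeToThree_of_muThree_nine_not27
    (hCH : ShimuraCharacterSupportLaw) (hS : MuThreeOptimalSignAtNine)
    (W : WeierstrassCurve ℚ) [W.IsElliptic] [W.IsGloballyMinimal] {N : ℕ} [NeZero N]
    (D : ModularParametrizationData W N) (hopt : ∀ z ∈ D.L.lattice, ∃ w ∈ periodLattice D.f, z = D.c * w)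
    (h9 : 3 ^ 2 ∣ N) (h27 : ¬ 3 ^ 3 ∣ N) (hμ : HasShortMuThree W D.c)
    (hT : ∀ X₀ Y₀ : ℚ, ¬ IsShortThreeTorsion W D.c X₀ Y₀) : PlusIndexPrimeTo 3 D.f := by
  have hε := hS W D hopt h9 h27 hμ hT
  have h3N : 3 ∣ N := (dvd_pow_self 3 two_ne_zero).trans h9
  exact plusIndexPrimeTo_of_shimuraIndexPrimeTo Nat.prime_three D.f
    (shimuraIndexPrimeTo_of_signAtP hCH D.f D.isNewformOf.1 Nat.prime_three (by decide) h3N h27 hε)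

/-- **E-es-67♯ = (9 ∥ N branch, from the laws) ∧ E-es-67♯₂₇** (PROVED). -/
theorem plusIndexPrimeToThreeOfMuThreeNoRationalThreeTorsion_of_laws
    (hCH : ShimuraCharacterSupportLaw) (hS : MuThreeOptimalSignAtNine)
    (h27 : PlusIndexPrimeToThreeOfMuThreeAt27) : PlusIndexPrimeToThreeOfMuThreeNoRationalThreeTorsion := by
  intro W _ _ N _ D hopt h9 hμ hT
  by_cases h : 3 ^ 3 ∣ N
  · exact h27 W D hopt h hμ hT
  · exact plusIndexPrimeToThree_of_muThree_nine_not27 hCH hS W D hopt h9 h hμ hT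

/-- **The 3-adic polar witness on the `9 ∥ N` μ₃-locus** (PROVED glue): with E-es-66 the laws give the C3 input
E-es-61 there. -/
theorem threeAdicPolarWitness_of_muThree_nine_not27 (h66 : ThreeAdicWitnessOfPlusIndexPrimeToThree)
    (hCH : ShimuraCharacterSupportLaw)
    (hS : MuThreeOptimalSignAtNine) (W : WeierstrassCurve ℚ) [W.IsElliptic] [W.IsGloballyMinimal] {N : ℕ}
    [NeZero N] (D : ModularParametrizationData W N)
    (hopt : ∀ z ∈ D.L.lattice, ∃ w ∈ periodLattice D.f, z = D.c * w) (h9 : 3 ^ 2 ∣ N) (h27 : ¬ 3 ^ 3 ∣ N)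
    (hμ : HasShortMuThree W D.c) (hT : ∀ X₀ Y₀ : ℚ, ¬ IsShortThreeTorsion W D.c X₀ Y₀) :
    ThreeAdicPolarWitness W W D.f :=
  h66 W D hopt h9 (plusIndexPrimeToThree_of_muThree_nine_not27 hCH hS W D hopt h9 h27 hμ hT)

/-- **Odd analytic rank** (PROVED, unconditional given the Fricke sign): `w_N f = f` ⟹ E-es-66's hypothesis,
hence (with E-es-66) the 3-adic polar witness — no `μ₃` / torsion / `27` hypothesis at all. -/
theorem threeAdicPolarWitness_of_frickePlus (h66 : ThreeAdicWitnessOfPlusIndexPrimeToThree)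
    (W : WeierstrassCurve ℚ) [W.IsElliptic] [W.IsGloballyMinimal] {N : ℕ} [NeZero N]
    (D : ModularParametrizationData W N) (hopt : ∀ z ∈ D.L.lattice, ∃ w ∈ periodLattice D.f, z = D.c * w)
    (h9 : 3 ^ 2 ∣ N) (hW : IsFrickeEigen N D.f 1) : ThreeAdicPolarWitness W W D.f :=
  h66 W D hopt h9 (plusIndexPrimeTo_of_frickePlus D.f hW Nat.prime_three (by decide))

/-- **Root number `−1`, conductor level** (PROVED): E-es-66 ⟹ the 3-adic polar witness for every optimal
`X₀(N_W)`-datum with `9 ∣ N_W` and `w(W) = −1` — the odd-rank half of stub 5's input E-es-61 needs no E-es-67. -/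
theorem threeAdicPolarWitness_of_rootNumber_eq_neg_one (h66 : ThreeAdicWitnessOfPlusIndexPrimeToThree)
    (W : WeierstrassCurve ℚ) [W.IsElliptic] [W.IsGloballyMinimal] [NeZero (W.conductorNorm ℤ)]
    (D : ModularParametrizationData W (W.conductorNorm ℤ))
    (hopt : ∀ z ∈ D.L.lattice, ∃ w ∈ periodLattice D.f, z = D.c * w) (h9 : 3 ^ 2 ∣ W.conductorNorm ℤ)
    (hw : W.rootNumber = -1) : ThreeAdicPolarWitness W W D.f :=
  h66 W D hopt h9 (plusIndexPrimeTo_of_rootNumber_eq_neg_one W D hw Nat.prime_three (by decide))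

end Summit.BirchSwinnertonDyer.Rank1Residual.ManinAdditive.KatoCurve

end
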